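import Literature.Topology.FourManifolds.StableFramesAlongDiscs
import Literature.Topology.FourManifolds.StableRangeFramePeel
import Literature.Topology.FourManifolds.StableRangeGLPeel
import Mathlib.Geometry.Manifold.Instances.Sphere
import HarnessLib

/-!
# The transition matrix between the tube framing and the handle framing of a surgery
# (the "swap" `u ↔ v` of Milnor's identification `(u, θv) ∼ (θu, v)`), and its triviality

Topic `Literature/Topology/FourManifolds` (infrastructure for the fact seat of
`Literature.Topology.FourManifolds.HomotopySphere.exists_highlyConnected_of_mem_signatureSet`,
brick B5-X: the re-framing half of Kosinski X.(2.1) / Kervaire–Milnor Lemma 5.4).  The surgered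
manifold `χ(W, φ)` is the union of `W ∖ S` and of the handle `OD^{k+1} × Sˡ`, glued along
`φ(u, θv) ∼ (θu, v)` (Milnor 1965, Def. 3.11).  Both pieces carry a natural stable framing of
their tangent bundle coming from the hypersurfaces `Sᵏ × ℝᵐ ⊂ ℝ^{k+1} × ℝᵐ` (unit normal `(u, 0)`)
and `ℝ^{k+1} × Sˡ ⊂ ℝ^{k+1} × ℝᵐ` (unit normal `(0, v)`), `m = l + 1`: the **cylinder frames**
`cylT`, `cylR` below (the `k + 1 + m` basis vectors of `E = ℝ^{k+1} × ℝᵐ` split into tangential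
part, pushed by the differential `L` of the parametrisation, and normal coefficient).  This file
computes, by pure linear algebra, the comparison matrix of the two frames at a common point and
shows that it is homotopically trivial:

* §1 `jbasis` (the basis `(eᵢ, 0), (0, fⱼ)` of `E`, indexed by `Fin (N' + 1)`,
  `k + 1 + m = N' + 1`), the functionals `aF u = ⟪u, ·₁⟫`, `bF v = ⟪v, ·₂⟫`, the projections
  `PT`, `QR` off the normals, the linear change of variables `KK u v θ` (the differential of
  `(y, x) ↦ (y, ‖y‖ x/‖x‖)` at `(θu, v)` composed with the homogeneity rescaling `y ↦ y/θ`), the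
  scalings `Λ u v θ`, the **swap** `SW u v` (exchange of the `u`- and `v`-components: the
  reflection in `(u, -v)/√2`) and `XX u v θ = SW ∘ Λ θ`; the identities `PT ∘ XX = PT ∘ KK ∘ QR`,
  `aF ∘ XX = bF` (`PT_comp_XX`, `aF_comp_XX`), `SW ∘ SW = 1`, `Λ θ ∘ Λ θ⁻¹ = 1`;
* §2 the cylinder frames `cylT u L`, `cylR v L'` (`Fr N'`-valued), their linear independence, and
  the **transition formula** `cylR v (L ∘ KK u v θ) = act (cylT u L) (Xmat u v θ)`, hence
  `compMat (cylR …) (cylT …) = Xmat u v θ` (`compMat_cylR_cylT`), where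
  `Xmat u v θ = [XX u v θ]_{jbasis}` has non-zero determinant and depends continuously on
  `(u, v, θ)`;
* §3 **triviality**: `Xmat u v 1` is the Householder matrix of the coordinates of `(u, -v)`
  (`Xmat_one_eq_reflMat`), and since `(u, v) ↦ (u, -v)/√2 : Sᵏ × Sˡ → S^{N'}` is a smooth map
  from a manifold of dimension `k + l < N'` it misses a point
  (`exists_sphereMap_near_missing_antipode`), so for every `θ₀ > 0` the map
  `(u, v) ↦ Xmat u v θ₀ : Sᵏ × Sˡ → GL_{N'+1}(ℝ)` is homotopic to a constant
  (`Xmat_homotopic_const`).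

In `SurgeryTubeFrames.lean` `L` is the differential of the cone `(z, w) ↦ φ(z/‖z‖, w)` of the
framed sphere `φ : Sᵏ × ℝᵐ → W` at `(u, θv)` and `L ∘ KK u v θ` that of
`(y, x) ↦ φ(y/‖y‖, ‖y‖ x/‖x‖)` at `(θu, v)`, so that `cylT`, `cylR` are the two framings read at
the common point `φ(u, θv)`.  Everything here is proved; no named facts; the `def`s are explicit
linear maps / matrices.

## References

* J. Milnor, *Lectures on the h-cobordism theorem* (1965), Def. 3.11. [MilnorHCobordism1965]
* A. Kosinski, *Differential Manifolds* (1993), X, Lemma (2.1) and p. 200. [Kosinski1993]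
* M. Kervaire, J. Milnor, *Groups of homotopy spheres I*, Ann. of Math. 77 (1963), Lemma 5.4,
  Lemma 6.2. [KervaireMilnorAnnals1963]
-/

open scoped Manifold ContDiff Topology RealInnerProductSpace
open Set Function Metric Matrix Module

noncomputable section

namespace Literature.Topology.FourManifolds

namespace StableFrames

namespace SurgerySwap

open SOTransport

/-- Local notation: `𝔼 n` is the model Euclidean space `EuclideanSpace ℝ (Fin n)`. -/
local notation "𝔼 " n:arg => EuclideanSpace ℝ (Fin n)
/-- Local notation: `𝕊 n` is the unit sphere in `EuclideanSpace ℝ (Fin (n + 1))`. -/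
local notation "𝕊 " n:arg => (Metric.sphere (0 : EuclideanSpace ℝ (Fin (n + 1))) 1)

attribute [local instance] fact_finrank_euclideanSpace_succ

variable {k m N' : ℕ}

/-! ### §1 The basis, the functionals, the projections, the swap -/

/-- The basis `(e₀,0),…,(e_k,0),(0,f₀),…,(0,f_{m-1})` of `E = ℝ^{k+1} × ℝᵐ`, indexed by
`Fin (N' + 1)` through `k + 1 + m = N' + 1`. [folklore] -/
def jbasis (h : k + 1 + m = N' + 1) : Basis (Fin (N' + 1)) ℝ ((𝔼 (k + 1)) × (𝔼 m)) :=
  (((EuclideanSpace.basisFun (Fin (k + 1)) ℝ).toBasis.prod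
    (EuclideanSpace.basisFun (Fin m) ℝ).toBasis).reindex (finSumFinEquiv.trans (finCongr h)))

/-- The vectors of `jbasis` coming from the first factor. [folklore] -/
theorem jbasis_inl (h : k + 1 + m = N' + 1) (a : Fin (k + 1)) :
    jbasis h (finCongr h (finSumFinEquiv (Sum.inl a))) = (EuclideanSpace.single a 1, 0) := by
  rw [jbasis, Basis.reindex_apply]
  simp [Basis.prod_apply, Sum.elim_inl]

/-- The vectors of `jbasis` coming from the second factor. [folklore] -/
theorem jbasis_inr (h : k + 1 + m = N' + 1) (b : Fin m) :
    jbasis h (finCongr h (finSumFinEquiv (Sum.inr b))) = (0, EuclideanSpace.single b 1) := by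
  rw [jbasis, Basis.reindex_apply]
  simp [Basis.prod_apply, Sum.elim_inr]

/-- Every index of `Fin (N' + 1)` comes from the first or the second factor. [folklore] -/
theorem exists_index (h : k + 1 + m = N' + 1) (i : Fin (N' + 1)) :
    (∃ a : Fin (k + 1), i = finCongr h (finSumFinEquiv (Sum.inl a))) ∨
      ∃ b : Fin m, i = finCongr h (finSumFinEquiv (Sum.inr b)) := by
  obtain ⟨s, hs⟩ := (finSumFinEquiv.trans (finCongr h)).surjective i
  rcases s with a | b
  · exact Or.inl ⟨a, by rw [← hs]; rfl⟩
  · exact Or.inr ⟨b, by rw [← hs]; rfl⟩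

variable (p : (𝔼 (k + 1)) × (𝔼 m))

/-- The functional `e ↦ ⟪u, e₁⟫`, `u = p.1` (normal coefficient of the tube hypersurface
`Sᵏ × ℝᵐ`). [folklore] -/
def aF : ((𝔼 (k + 1)) × (𝔼 m)) →ₗ[ℝ] ℝ := (innerₗ _ p.1).comp (LinearMap.fst ℝ _ _)

/-- The functional `e ↦ ⟪v, e₂⟫`, `v = p.2` (normal coefficient of the handle hypersurface
`ℝ^{k+1} × Sˡ`). [folklore] -/
def bF : ((𝔼 (k + 1)) × (𝔼 m)) →ₗ[ℝ] ℝ := (innerₗ _ p.2).comp (LinearMap.snd ℝ _ _)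

/-- Values of `aF`. [folklore] -/
@[simp] theorem aF_apply (e : (𝔼 (k + 1)) × (𝔼 m)) : aF p e = ⟪p.1, e.1⟫ := rfl
/-- Values of `bF`. [folklore] -/
@[simp] theorem bF_apply (e : (𝔼 (k + 1)) × (𝔼 m)) : bF p e = ⟪p.2, e.2⟫ := rfl

/-- The tube normal `(u, 0)`. [folklore] -/
def nT : (𝔼 (k + 1)) × (𝔼 m) := (p.1, 0)
/-- The handle normal `(0, v)`. [folklore] -/
def nR : (𝔼 (k + 1)) × (𝔼 m) := (0, p.2)

/-- Components of `nT`. [folklore] -/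
@[simp] theorem nT_fst : (nT p).1 = p.1 := rfl
/-- Components of `nT`. [folklore] -/
@[simp] theorem nT_snd : (nT p).2 = 0 := rfl
/-- Components of `nR`. [folklore] -/
@[simp] theorem nR_fst : (nR p).1 = 0 := rfl
/-- Components of `nR`. [folklore] -/
@[simp] theorem nR_snd : (nR p).2 = p.2 := rfl

/-- The projection `e ↦ e - ⟪u, e₁⟫ (u, 0)` off the tube normal. [folklore] -/
def PT : ((𝔼 (k + 1)) × (𝔼 m)) →ₗ[ℝ] ((𝔼 (k + 1)) × (𝔼 m)) :=
  LinearMap.id - (aF p).smulRight (nT p)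

/-- The projection `e ↦ e - ⟪v, e₂⟫ (0, v)` off the handle normal. [folklore] -/
def QR : ((𝔼 (k + 1)) × (𝔼 m)) →ₗ[ℝ] ((𝔼 (k + 1)) × (𝔼 m)) :=
  LinearMap.id - (bF p).smulRight (nR p)

/-- Values of `PT`. [folklore] -/
@[simp] theorem PT_apply (e : (𝔼 (k + 1)) × (𝔼 m)) :
    PT p e = (e.1 - ⟪p.1, e.1⟫ • p.1, e.2) := by
  refine Prod.ext ?_ ?_ <;> simp [PT, nT]

/-- Values of `QR`. [folklore] -/
@[simp] theorem QR_apply (e : (𝔼 (k + 1)) × (𝔼 m)) :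
    QR p e = (e.1, e.2 - ⟪p.2, e.2⟫ • p.2) := by
  refine Prod.ext ?_ ?_ <;> simp [QR, nR]

/-- The change of variables `KK θ (ẏ, ẋ) = (ẏ/θ, ⟪u, ẏ⟫ v + θ (ẋ - ⟪v, ẋ⟫ v))` — the differential at
`(θu, v)` of `(y, x) ↦ (y, ‖y‖ x/‖x‖)` followed by the rescaling `ẏ ↦ ẏ/θ`. [folklore] -/
def KK (θ : ℝ) : ((𝔼 (k + 1)) × (𝔼 m)) →ₗ[ℝ] ((𝔼 (k + 1)) × (𝔼 m)) :=
  θ⁻¹ • ((LinearMap.inl ℝ _ _).comp (LinearMap.fst ℝ _ _)) +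
    θ • ((LinearMap.inr ℝ _ _).comp (LinearMap.snd ℝ _ _)) +
      (aF p - θ • bF p).smulRight (nR p)

/-- Values of `KK`. [folklore] -/
@[simp] theorem KK_apply (θ : ℝ) (e : (𝔼 (k + 1)) × (𝔼 m)) :
    KK p θ e = (θ⁻¹ • e.1, ⟪p.1, e.1⟫ • p.2 + θ • (e.2 - ⟪p.2, e.2⟫ • p.2)) := by
  refine Prod.ext ?_ ?_
  · simp [KK, nR]
  · simp [KK, nR]
    module

/-- The scalings `Λ θ`: `1/θ` on `u^⊥ ⊂ ℝ^{k+1}`, `θ` on `v^⊥ ⊂ ℝᵐ`, `1` on `u` and on `v`.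
[folklore] -/
def Λ (θ : ℝ) : ((𝔼 (k + 1)) × (𝔼 m)) →ₗ[ℝ] ((𝔼 (k + 1)) × (𝔼 m)) :=
  LinearMap.id + (θ⁻¹ - 1) • ((LinearMap.inl ℝ _ _).comp (LinearMap.fst ℝ _ _) -
      (aF p).smulRight (nT p)) +
    (θ - 1) • ((LinearMap.inr ℝ _ _).comp (LinearMap.snd ℝ _ _) - (bF p).smulRight (nR p))

/-- Values of `Λ`. [folklore] -/
@[simp] theorem Λ_apply (θ : ℝ) (e : (𝔼 (k + 1)) × (𝔼 m)) :
    Λ p θ e = (⟪p.1, e.1⟫ • p.1 + θ⁻¹ • (e.1 - ⟪p.1, e.1⟫ • p.1),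
      ⟪p.2, e.2⟫ • p.2 + θ • (e.2 - ⟪p.2, e.2⟫ • p.2)) := by
  refine Prod.ext ?_ ?_
  · simp [Λ, nT, nR]
    module
  · simp [Λ, nT, nR]
    module

/-- The **swap** `SW e = (e₁ - ⟪u,e₁⟫ u + ⟪v,e₂⟫ u, e₂ - ⟪v,e₂⟫ v + ⟪u,e₁⟫ v)`: exchange of the
`u`- and `v`-components — the reflection of `E` in the hyperplane orthogonal to `(u, -v)`.
[folklore] -/
def SW : ((𝔼 (k + 1)) × (𝔼 m)) →ₗ[ℝ] ((𝔼 (k + 1)) × (𝔼 m)) :=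
  LinearMap.id + (bF p - aF p).smulRight (nT p) + (aF p - bF p).smulRight (nR p)

/-- Values of `SW`. [folklore] -/
@[simp] theorem SW_apply (e : (𝔼 (k + 1)) × (𝔼 m)) :
    SW p e = (e.1 - ⟪p.1, e.1⟫ • p.1 + ⟪p.2, e.2⟫ • p.1,
      e.2 - ⟪p.2, e.2⟫ • p.2 + ⟪p.1, e.1⟫ • p.2) := by
  refine Prod.ext ?_ ?_
  · simp [SW, nT, nR]
    module
  · simp [SW, nT, nR]
    module

/-- The transition map `XX θ = SW ∘ Λ θ`. [folklore] -/
def XX (θ : ℝ) : ((𝔼 (k + 1)) × (𝔼 m)) →ₗ[ℝ] ((𝔼 (k + 1)) × (𝔼 m)) := (SW p).comp (Λ p θ)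

variable {p}

/-- Explicit formula for `XX θ` on unit `u`, `v`:
`XX θ e = (θ⁻¹ (e₁ - ⟪u,e₁⟫ u) + ⟪v,e₂⟫ u, θ (e₂ - ⟪v,e₂⟫ v) + ⟪u,e₁⟫ v)`. [folklore] -/
theorem XX_apply (hu : ‖p.1‖ = 1) (hv : ‖p.2‖ = 1) (θ : ℝ) (e : (𝔼 (k + 1)) × (𝔼 m)) :
    XX p θ e = (θ⁻¹ • (e.1 - ⟪p.1, e.1⟫ • p.1) + ⟪p.2, e.2⟫ • p.1,
      θ • (e.2 - ⟪p.2, e.2⟫ • p.2) + ⟪p.1, e.1⟫ • p.2) := by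
  have hu1 : ⟪p.1, p.1⟫ = 1 := by rw [real_inner_self_eq_norm_sq, hu, one_pow]
  have hv1 : ⟪p.2, p.2⟫ = 1 := by rw [real_inner_self_eq_norm_sq, hv, one_pow]
  rw [XX, LinearMap.comp_apply, Λ_apply, SW_apply]
  refine Prod.ext ?_ ?_
  · simp only [inner_add_right, inner_smul_right, inner_sub_right, hu1, hv1]
    module
  · simp only [inner_add_right, inner_smul_right, inner_sub_right, hu1, hv1]
    module

/-- **`PT ∘ XX = PT ∘ KK ∘ QR`** (unit `u`, `v`): off the tube normal, the transition map agrees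
with the differential of the handle parametrisation. [folklore] -/
theorem PT_XX (hu : ‖p.1‖ = 1) (hv : ‖p.2‖ = 1) (θ : ℝ) (e : (𝔼 (k + 1)) × (𝔼 m)) :
    PT p (XX p θ e) = PT p (KK p θ (QR p e)) := by
  have hu1 : ⟪p.1, p.1⟫ = 1 := by rw [real_inner_self_eq_norm_sq, hu, one_pow]
  have hv1 : ⟪p.2, p.2⟫ = 1 := by rw [real_inner_self_eq_norm_sq, hv, one_pow]
  rw [XX_apply hu hv, PT_apply, PT_apply, KK_apply, QR_apply]
  refine Prod.ext ?_ ?_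
  · simp only [inner_add_right, inner_smul_right, inner_sub_right, hu1]
    module
  · simp only [inner_sub_right, inner_smul_right, hv1]
    module

/-- **`aF ∘ XX = bF`** (unit `u`): the tube-normal coefficient of the transformed vector is the
handle-normal coefficient. [folklore] -/
theorem aF_XX (hu : ‖p.1‖ = 1) (hv : ‖p.2‖ = 1) (θ : ℝ) (e : (𝔼 (k + 1)) × (𝔼 m)) :
    aF p (XX p θ e) = bF p e := by
  have hu1 : ⟪p.1, p.1⟫ = 1 := by rw [real_inner_self_eq_norm_sq, hu, one_pow]
  rw [XX_apply hu hv, aF_apply, bF_apply]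
  simp only [inner_add_right, inner_smul_right, inner_sub_right, hu1]
  ring

/-- `SW ∘ SW = 1` (unit `u`, `v`). [folklore] -/
theorem SW_SW (hu : ‖p.1‖ = 1) (hv : ‖p.2‖ = 1) (e : (𝔼 (k + 1)) × (𝔼 m)) :
    SW p (SW p e) = e := by
  have hu1 : ⟪p.1, p.1⟫ = 1 := by rw [real_inner_self_eq_norm_sq, hu, one_pow]
  have hv1 : ⟪p.2, p.2⟫ = 1 := by rw [real_inner_self_eq_norm_sq, hv, one_pow]
  rw [SW_apply, SW_apply]
  refine Prod.ext ?_ ?_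
  · simp only [inner_add_right, inner_smul_right, inner_sub_right, hu1, hv1]
    module
  · simp only [inner_add_right, inner_smul_right, inner_sub_right, hu1, hv1]
    module

/-- `Λ θ ∘ Λ θ⁻¹ = 1` (unit `u`, `v`, `θ ≠ 0`). [folklore] -/
theorem Λ_Λ_inv (hu : ‖p.1‖ = 1) (hv : ‖p.2‖ = 1) {θ : ℝ} (hθ : θ ≠ 0) (e : (𝔼 (k + 1)) × (𝔼 m)) :
    Λ p θ (Λ p θ⁻¹ e) = e := by
  have hu1 : ⟪p.1, p.1⟫ = 1 := by rw [real_inner_self_eq_norm_sq, hu, one_pow]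
  have hv1 : ⟪p.2, p.2⟫ = 1 := by rw [real_inner_self_eq_norm_sq, hv, one_pow]
  rw [Λ_apply, Λ_apply, inv_inv]
  refine Prod.ext ?_ ?_
  · simp only [inner_add_right, inner_smul_right, inner_sub_right, hu1]
    match_scalars <;> first | (field_simp; done) | (field_simp; ring)
  · simp only [inner_add_right, inner_smul_right, inner_sub_right, hv1]
    match_scalars <;> first | (field_simp; done) | (field_simp; ring)

/-! ### §2 The matrix `Xmat`, the cylinder frames and the transition formula -/

variable (p)

/-- The **transition matrix** `Xmat θ = [XX θ]` in the basis `jbasis`. [folklore] -/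
def Xmat (h : k + 1 + m = N' + 1) (θ : ℝ) : Matrix (Fin (N' + 1)) (Fin (N' + 1)) ℝ :=
  LinearMap.toMatrix (jbasis h) (jbasis h) (XX p θ)

/-- Entries of `Xmat`: coordinates of `XX θ (jbasis j)`. [folklore] -/
theorem Xmat_apply (h : k + 1 + m = N' + 1) (θ : ℝ) (i j : Fin (N' + 1)) :
    Xmat p h θ i j = (jbasis h).repr (XX p θ (jbasis h j)) i :=
  LinearMap.toMatrix_apply _ _ _ _ _

/-- `∑ i, Xmat θ i j • jbasis i = XX θ (jbasis j)`. [folklore] -/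
theorem sum_Xmat_smul (h : k + 1 + m = N' + 1) (θ : ℝ) (j : Fin (N' + 1)) :
    ∑ i, Xmat p h θ i j • jbasis h i = XX p θ (jbasis h j) := by
  simp_rw [Xmat_apply]
  exact (jbasis h).sum_repr _

/-- The **tube cylinder frame**: tangential parts `L (PT eᵢ)` and normal coefficients `⟪u, (eᵢ)₁⟫`
of the basis vectors (`L` the differential of the cone of the tube parametrisation, which kills
the normal `(u, 0)`). [folklore] -/
def cylT (h : k + 1 + m = N' + 1) (L : ((𝔼 (k + 1)) × (𝔼 m)) →ₗ[ℝ] (𝔼 N')) : Fr N' :=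
  fun i => (L (PT p (jbasis h i)), aF p (jbasis h i))

/-- The **handle cylinder frame**: tangential parts `L' (QR eᵢ)` and normal coefficients
`⟪v, (eᵢ)₂⟫`. [folklore] -/
def cylR (h : k + 1 + m = N' + 1) (L' : ((𝔼 (k + 1)) × (𝔼 m)) →ₗ[ℝ] (𝔼 N')) : Fr N' :=
  fun i => (L' (QR p (jbasis h i)), bF p (jbasis h i))

variable {p}

/-- **The transition formula**: at the common point, the handle frame for the differential
`L ∘ KK θ` is the tube frame for `L` acted on by `Xmat θ` — provided `L` kills the tube normal
(the cone is constant along rays). [folklore] -/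
theorem cylR_eq_act (hu : ‖p.1‖ = 1) (hv : ‖p.2‖ = 1) (h : k + 1 + m = N' + 1) {θ : ℝ}
    {L : ((𝔼 (k + 1)) × (𝔼 m)) →ₗ[ℝ] (𝔼 N')} (hL : L (nT p) = 0) :
    cylR p h (L.comp (KK p θ)) = act (cylT p h L) (Xmat p h θ) := by
  -- `L ∘ PT = L`
  have hLP : ∀ e, L (PT p e) = L e := fun e => by
    have : PT p e = e - ⟪p.1, e.1⟫ • nT p := by
      refine Prod.ext ?_ ?_ <;> simp [nT]
    rw [this, map_sub, map_smul, hL, smul_zero, sub_zero]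
  funext j
  -- the linear map `e ↦ (L (PT e), aF e)`
  set Φ : ((𝔼 (k + 1)) × (𝔼 m)) →ₗ[ℝ] (𝔼 N') × ℝ := (L.comp (PT p)).prod (aF p) with hΦ
  have hΦT : ∀ i, cylT p h L i = Φ (jbasis h i) := fun i => rfl
  have hΦapply : ∀ e, Φ e = (L (PT p e), aF p e) := fun e => rfl
  calc cylR p h (L.comp (KK p θ)) j
      = (L (KK p θ (QR p (jbasis h j))), bF p (jbasis h j)) := rfl
    _ = Φ (XX p θ (jbasis h j)) := by
        rw [hΦapply, aF_XX hu hv, PT_XX hu hv, hLP]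
    _ = Φ (∑ i, Xmat p h θ i j • jbasis h i) := by rw [sum_Xmat_smul]
    _ = ∑ i, Xmat p h θ i j • Φ (jbasis h i) := by rw [map_sum]; simp_rw [map_smul]
    _ = act (cylT p h L) (Xmat p h θ) j := by
        simp only [act, hΦT]

/-- Sums of multiples of a product-valued family, componentwise. [folklore] -/
theorem sum_smul_prod_eq {ι : Type*} [Fintype ι] {A B : Type*} [AddCommGroup A] [Module ℝ A]
    [AddCommGroup B] [Module ℝ B] (c : ι → ℝ) (F : ι → A × B) :
    ∑ i, c i • F i = (∑ i, c i • (F i).1, ∑ i, c i • (F i).2) := by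
  refine Prod.ext ?_ ?_
  · rw [Prod.fst_sum]; rfl
  · rw [Prod.snd_sum]; rfl

/-- **The tube cylinder frame is a frame** when `L` is injective on the tangent space of the
cylinder (`⟪u, x₁⟫ = 0 ∧ L x = 0 ⇒ x = 0`). [folklore] -/
theorem linearIndependent_cylT (h : k + 1 + m = N' + 1) {L : ((𝔼 (k + 1)) × (𝔼 m)) →ₗ[ℝ] (𝔼 N')}
    (hL : ∀ x, ⟪p.1, x.1⟫ = 0 → L x = 0 → x = 0) : LinearIndependent ℝ (cylT p h L) := by
  rw [Fintype.linearIndependent_iff]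
  intro c hc
  set x := ∑ i, c i • jbasis h i with hx
  set Φ : ((𝔼 (k + 1)) × (𝔼 m)) →ₗ[ℝ] (𝔼 N') × ℝ := (L.comp (PT p)).prod (aF p) with hΦ
  have h1 : ∑ i, c i • cylT p h L i = Φ x := by
    rw [hx, map_sum]
    exact Finset.sum_congr rfl fun i _ => by rw [map_smul]; rfl
  rw [h1] at hc
  have ha : ⟪p.1, x.1⟫ = 0 := by
    have := congrArg Prod.snd hc
    simpa [hΦ] using this
  have hLx : L x = 0 := by
    have := congrArg Prod.fst hc
    simpa [hΦ, ha] using this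
  have hx0 : x = 0 := hL x ha hLx
  have := (jbasis h).linearIndependent
  rw [Fintype.linearIndependent_iff] at this
  exact this c (by rw [← hx]; exact hx0)

/-- **The handle cylinder frame is a frame** when `L'` is injective on the tangent space of the
cylinder (`⟪v, x₂⟫ = 0 ∧ L' x = 0 ⇒ x = 0`). [folklore] -/
theorem linearIndependent_cylR (h : k + 1 + m = N' + 1) {L' : ((𝔼 (k + 1)) × (𝔼 m)) →ₗ[ℝ] (𝔼 N')}
    (hL : ∀ x, ⟪p.2, x.2⟫ = 0 → L' x = 0 → x = 0) : LinearIndependent ℝ (cylR p h L') := by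
  rw [Fintype.linearIndependent_iff]
  intro c hc
  set x := ∑ i, c i • jbasis h i with hx
  set Φ : ((𝔼 (k + 1)) × (𝔼 m)) →ₗ[ℝ] (𝔼 N') × ℝ := (L'.comp (QR p)).prod (bF p) with hΦ
  have h1 : ∑ i, c i • cylR p h L' i = Φ x := by
    rw [hx, map_sum]
    exact Finset.sum_congr rfl fun i _ => by rw [map_smul]; rfl
  rw [h1] at hc
  have hb : ⟪p.2, x.2⟫ = 0 := by
    have := congrArg Prod.snd hc
    simpa [hΦ] using this
  have hLx : L' x = 0 := by
    have := congrArg Prod.fst hc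
    simpa [hΦ, hb] using this
  have hx0 : x = 0 := hL x hb hLx
  have := (jbasis h).linearIndependent
  rw [Fintype.linearIndependent_iff] at this
  exact this c (by rw [← hx]; exact hx0)

/-- The kernel of `L` is the line of the tube normal when `L` kills the normal and is injective
on its orthogonal complement. [folklore] -/
theorem eq_smul_nT_of_apply_eq_zero {V' : Type*} [AddCommGroup V'] [Module ℝ V']
    {L : ((𝔼 (k + 1)) × (𝔼 m)) →ₗ[ℝ] V'} (hL : L (nT p) = 0)
    (hLi : ∀ x, ⟪p.1, x.1⟫ = 0 → L x = 0 → x = 0) (hu : ‖p.1‖ = 1)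
    {y : (𝔼 (k + 1)) × (𝔼 m)} (hy : L y = 0) : y = ⟪p.1, y.1⟫ • nT p := by
  have hu1 : ⟪p.1, p.1⟫ = 1 := by rw [real_inner_self_eq_norm_sq, hu, one_pow]
  have hP : PT p y = y - ⟪p.1, y.1⟫ • nT p := by
    refine Prod.ext ?_ ?_ <;> simp [nT]
  have h1 : L (PT p y) = 0 := by rw [hP, map_sub, map_smul, hL, hy, smul_zero, sub_zero]
  have h2 : ⟪p.1, (PT p y).1⟫ = 0 := by
    rw [PT_apply]; simp only [inner_sub_right, inner_smul_right, hu1]; ring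
  have h3 := hLi _ h2 h1
  rw [hP, sub_eq_zero] at h3
  exact h3

/-- **The handle frame for `L ∘ KK θ` is a frame** (`θ ≠ 0`, unit `u`, `v`) when `L` kills the
tube normal and is injective on its complement. [folklore] -/
theorem linearIndependent_cylR_comp_KK (hu : ‖p.1‖ = 1) (hv : ‖p.2‖ = 1) (h : k + 1 + m = N' + 1)
    {θ : ℝ} (hθ : θ ≠ 0) {L : ((𝔼 (k + 1)) × (𝔼 m)) →ₗ[ℝ] (𝔼 N')} (hL : L (nT p) = 0)
    (hLi : ∀ x, ⟪p.1, x.1⟫ = 0 → L x = 0 → x = 0) :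
    LinearIndependent ℝ (cylR p h (L.comp (KK p θ))) := by
  have hv1 : ⟪p.2, p.2⟫ = 1 := by rw [real_inner_self_eq_norm_sq, hv, one_pow]
  refine linearIndependent_cylR h fun x hx h0 => ?_
  rw [LinearMap.comp_apply] at h0
  have hker := eq_smul_nT_of_apply_eq_zero hL hLi hu h0
  rw [KK_apply] at hker
  have h2 := congrArg Prod.snd hker
  have h1 := congrArg Prod.fst hker
  simp only [nT, Prod.smul_mk, smul_zero, hx, zero_smul, sub_zero] at h2 h1
  -- `⟪u, x₁⟫ v + θ x₂ = 0`; pairing with `v`: `⟪u, x₁⟫ = 0`, then `x₂ = 0`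
  have ha : ⟪p.1, x.1⟫ = 0 := by
    have := congrArg (fun w => ⟪p.2, w⟫) h2
    simp only [inner_add_right, inner_smul_right, hv1, hx, mul_one, mul_zero, add_zero,
      inner_zero_right] at this
    exact this
  rw [ha, zero_smul, zero_add, smul_eq_zero] at h2
  have hx2 : x.2 = 0 := h2.resolve_left hθ
  -- first component: `θ⁻¹ x₁ = ⟪u, θ⁻¹ x₁⟫ u`, and `⟪u, x₁⟫ = 0`
  simp only [inner_smul_right, ha, mul_zero, zero_smul, smul_eq_zero, inv_eq_zero] at h1
  have hx1 : x.1 = 0 := h1.resolve_left hθ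
  exact Prod.ext hx1 hx2

/-- **The comparison matrix of the handle frame against the tube frame is `Xmat θ`.**
[folklore] -/
theorem compMat_cylR_cylT (hu : ‖p.1‖ = 1) (hv : ‖p.2‖ = 1) (h : k + 1 + m = N' + 1) {θ : ℝ}
    {L : ((𝔼 (k + 1)) × (𝔼 m)) →ₗ[ℝ] (𝔼 N')} (hL : L (nT p) = 0)
    (hLi : ∀ x, ⟪p.1, x.1⟫ = 0 → L x = 0 → x = 0) :
    compMat (cylR p h (L.comp (KK p θ))) (cylT p h L) = Xmat p h θ := by
  rw [cylR_eq_act hu hv h hL]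
  exact compMat_act_self (linearIndependent_cylT h hLi) _

/-- `det (Xmat θ) ≠ 0` for `θ ≠ 0` (unit `u`, `v`): `XX θ = SW ∘ Λ θ` with `SW² = 1` and `Λ θ`
invertible. [folklore] -/
theorem det_Xmat_ne_zero (hu : ‖p.1‖ = 1) (hv : ‖p.2‖ = 1) (h : k + 1 + m = N' + 1) {θ : ℝ}
    (hθ : θ ≠ 0) : (Xmat p h θ).det ≠ 0 := by
  have hS : LinearMap.toMatrix (jbasis h) (jbasis h) (SW p) *
      LinearMap.toMatrix (jbasis h) (jbasis h) (SW p) = 1 := by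
    rw [← LinearMap.toMatrix_comp, show (SW p).comp (SW p) = LinearMap.id from
      LinearMap.ext fun e => SW_SW hu hv e, LinearMap.toMatrix_id]
  have hΛ : LinearMap.toMatrix (jbasis h) (jbasis h) (Λ p θ) *
      LinearMap.toMatrix (jbasis h) (jbasis h) (Λ p θ⁻¹) = 1 := by
    rw [← LinearMap.toMatrix_comp, show (Λ p θ).comp (Λ p θ⁻¹) = LinearMap.id from
      LinearMap.ext fun e => Λ_Λ_inv hu hv hθ e, LinearMap.toMatrix_id]
  have hdS := congrArg Matrix.det hS
  have hdΛ := congrArg Matrix.det hΛ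
  rw [det_mul, det_one] at hdS hdΛ
  rw [Xmat, XX, LinearMap.toMatrix_comp _ (jbasis h), det_mul]
  exact mul_ne_zero (fun h0 => by rw [h0, zero_mul] at hdS; exact zero_ne_one hdS)
    (fun h0 => by rw [h0, zero_mul] at hdΛ; exact zero_ne_one hdΛ)

/-- **`Xmat` depends continuously on `(u, v, θ)`** (`θ ≠ 0`). [folklore] -/
theorem continuous_Xmat {Y : Type*} [TopologicalSpace Y] (h : k + 1 + m = N' + 1)
    {fp : Y → (𝔼 (k + 1)) × (𝔼 m)} {fθ : Y → ℝ} (hfp : Continuous fp)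
    (hfθ : Continuous fθ) (hθ : ∀ y, fθ y ≠ 0) :
    Continuous fun y => Xmat (fp y) h (fθ y) := by
  refine continuous_matrix fun i j => ?_
  simp_rw [Xmat_apply]
  have hrepr : Continuous fun e : (𝔼 (k + 1)) × (𝔼 m) => (jbasis h).repr e i :=
    ((jbasis h).coord i).continuous_of_finiteDimensional
  refine hrepr.comp ?_
  have hform : ∀ y, XX (fp y) (fθ y) (jbasis h j) =
      SW (fp y) (Λ (fp y) (fθ y) (jbasis h j)) := fun y => rfl
  simp_rw [hform, SW_apply, Λ_apply]
  set e := jbasis h j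
  have hfu : Continuous fun y => (fp y).1 := continuous_fst.comp hfp
  have hfv : Continuous fun y => (fp y).2 := continuous_snd.comp hfp
  have h1 : Continuous fun y => ⟪(fp y).1, e.1⟫ := Continuous.inner (𝕜 := ℝ) hfu continuous_const
  have h2 : Continuous fun y => ⟪(fp y).2, e.2⟫ := Continuous.inner (𝕜 := ℝ) hfv continuous_const
  have hx1 : Continuous fun y =>
      ⟪(fp y).1, e.1⟫ • (fp y).1 + (fθ y)⁻¹ • (e.1 - ⟪(fp y).1, e.1⟫ • (fp y).1) :=
    (h1.smul hfu).add ((hfθ.inv₀ hθ).smul (continuous_const.sub (h1.smul hfu)))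
  have hx2 : Continuous fun y =>
      ⟪(fp y).2, e.2⟫ • (fp y).2 + fθ y • (e.2 - ⟪(fp y).2, e.2⟫ • (fp y).2) :=
    (h2.smul hfv).add (hfθ.smul (continuous_const.sub (h2.smul hfv)))
  refine Continuous.prodMk ?_ ?_
  · exact ((hx1.sub ((Continuous.inner (𝕜 := ℝ) hfu hx1).smul hfu)).add ((Continuous.inner (𝕜 := ℝ) hfv hx2).smul hfu))
  · exact ((hx2.sub ((Continuous.inner (𝕜 := ℝ) hfv hx2).smul hfv)).add ((Continuous.inner (𝕜 := ℝ) hfu hx1).smul hfv))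

/-! ### §3 Triviality: `Xmat 1` is a Householder matrix, and `Xmat θ₀` is null-homotopic on `Sᵏ × Sˡ` -/

/-- `Λ 1 = 1`. [folklore] -/
theorem Λ_one (p : (𝔼 (k + 1)) × (𝔼 m)) (e : (𝔼 (k + 1)) × (𝔼 m)) : Λ p 1 e = e := by
  rw [Λ_apply, inv_one, one_smul, one_smul]
  refine Prod.ext ?_ ?_ <;> simp

/-- `SW e = e - (⟪u,e₁⟫ - ⟪v,e₂⟫) • (u, -v)`. [folklore] -/
theorem SW_eq_sub (p : (𝔼 (k + 1)) × (𝔼 m)) (e : (𝔼 (k + 1)) × (𝔼 m)) :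
    SW p e = e - (⟪p.1, e.1⟫ - ⟪p.2, e.2⟫) • (p.1, -p.2) := by
  rw [SW_apply]
  refine Prod.ext ?_ ?_
  · simp; module
  · simp; module

/-- **Expansion in `jbasis`**: `∑ᵢ (⟪(bᵢ)₁, e₁⟫ + ⟪(bᵢ)₂, e₂⟫) bᵢ = e` (the basis is orthonormal
for the sum of the two inner products). [folklore] -/
theorem sum_inner_jbasis_smul (h : k + 1 + m = N' + 1) (e : (𝔼 (k + 1)) × (𝔼 m)) :
    ∑ i, (⟪(jbasis h i).1, e.1⟫ + ⟪(jbasis h i).2, e.2⟫) • jbasis h i = e := by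
  rw [← Fintype.sum_equiv (finSumFinEquiv.trans (finCongr h))
    (fun s => (⟪(jbasis h ((finSumFinEquiv.trans (finCongr h)) s)).1, e.1⟫ +
      ⟪(jbasis h ((finSumFinEquiv.trans (finCongr h)) s)).2, e.2⟫) •
        jbasis h ((finSumFinEquiv.trans (finCongr h)) s)) _ (fun _ => rfl)]
  rw [Fintype.sum_sum_type]
  simp only [Equiv.trans_apply]
  simp_rw [jbasis_inl, jbasis_inr]
  have h1 : ∑ a : Fin (k + 1), (⟪EuclideanSpace.single a (1 : ℝ), e.1⟫ + ⟪(0 : 𝔼 m), e.2⟫) •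
      ((EuclideanSpace.single a (1 : ℝ), (0 : 𝔼 m)) : (𝔼 (k + 1)) × (𝔼 m)) = (e.1, 0) := by
    have := (EuclideanSpace.basisFun (Fin (k + 1)) ℝ).sum_repr' e.1
    simp only [EuclideanSpace.basisFun_apply] at this
    simp only [inner_zero_left, add_zero]
    rw [sum_smul_prod_eq]
    refine Prod.ext ?_ ?_
    · simpa using this
    · simp
  have h2 : ∑ b : Fin m, (⟪(0 : 𝔼 (k + 1)), e.1⟫ + ⟪EuclideanSpace.single b (1 : ℝ), e.2⟫) •
      (((0 : 𝔼 (k + 1)), EuclideanSpace.single b (1 : ℝ)) : (𝔼 (k + 1)) × (𝔼 m)) = (0, e.2) := by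
    have := (EuclideanSpace.basisFun (Fin m) ℝ).sum_repr' e.2
    simp only [EuclideanSpace.basisFun_apply] at this
    simp only [inner_zero_left, zero_add]
    rw [sum_smul_prod_eq]
    refine Prod.ext ?_ ?_
    · simp
    · simpa using this
  rw [h1, h2, Prod.mk_add_mk, add_zero, zero_add]

/-- **Coordinates in `jbasis`**: `b.repr e i = ⟪(bᵢ)₁, e₁⟫ + ⟪(bᵢ)₂, e₂⟫`. [folklore] -/
theorem jbasis_repr_apply (h : k + 1 + m = N' + 1) (e : (𝔼 (k + 1)) × (𝔼 m)) (i : Fin (N' + 1)) :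
    (jbasis h).repr e i = ⟪(jbasis h i).1, e.1⟫ + ⟪(jbasis h i).2, e.2⟫ := by
  conv_lhs => rw [← sum_inner_jbasis_smul h e]
  rw [(jbasis h).repr_sum_self]

/-- One component of each `jbasis` vector vanishes: `⟪(bᵢ)₁, x⟫ ⟪(bᵢ)₂, y⟫ = 0`. [folklore] -/
theorem inner_jbasis_fst_mul_snd (h : k + 1 + m = N' + 1) (i : Fin (N' + 1)) (x : 𝔼 (k + 1))
    (y : 𝔼 m) : ⟪(jbasis h i).1, x⟫ * ⟪(jbasis h i).2, y⟫ = 0 := by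
  rcases exists_index h i with ⟨a, rfl⟩ | ⟨b, rfl⟩
  · rw [jbasis_inl]; simp
  · rw [jbasis_inr]; simp

/-- Squares of the coordinates sum to the sum of the squared norms (Parseval for `jbasis`).
[folklore] -/
theorem sum_repr_sq (h : k + 1 + m = N' + 1) (e : (𝔼 (k + 1)) × (𝔼 m)) :
    ∑ i, ((jbasis h).repr e i) ^ 2 = ‖e.1‖ ^ 2 + ‖e.2‖ ^ 2 := by
  simp_rw [jbasis_repr_apply]
  rw [← Fintype.sum_equiv (finSumFinEquiv.trans (finCongr h))
    (fun s => (⟪(jbasis h ((finSumFinEquiv.trans (finCongr h)) s)).1, e.1⟫ +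
      ⟪(jbasis h ((finSumFinEquiv.trans (finCongr h)) s)).2, e.2⟫) ^ 2) _ (fun _ => rfl)]
  rw [Fintype.sum_sum_type]
  simp only [Equiv.trans_apply]
  simp_rw [jbasis_inl, jbasis_inr]
  simp only [inner_zero_left, add_zero, zero_add, EuclideanSpace.inner_single_left, map_one,
    one_mul]
  rw [EuclideanSpace.real_norm_sq_eq, EuclideanSpace.real_norm_sq_eq]

/-- The **coordinate vector of `(u, -v)`**: `w i = ⟪u, (bᵢ)₁⟫ - ⟪v, (bᵢ)₂⟫`. [folklore] -/
def wvec (p : (𝔼 (k + 1)) × (𝔼 m)) (h : k + 1 + m = N' + 1) : Fin (N' + 1) → ℝ :=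
  fun i => (jbasis h).repr (p.1, -p.2) i

/-- Entries of `wvec`. [folklore] -/
theorem wvec_apply (p : (𝔼 (k + 1)) × (𝔼 m)) (h : k + 1 + m = N' + 1) (i : Fin (N' + 1)) :
    wvec p h i = ⟪p.1, (jbasis h i).1⟫ - ⟪p.2, (jbasis h i).2⟫ := by
  rw [wvec, jbasis_repr_apply, inner_neg_right, real_inner_comm, real_inner_comm p.2]
  ring

/-- `wvec ⬝ wvec = ‖u‖² + ‖v‖²`. [folklore] -/
theorem wvec_dotProduct_self (p : (𝔼 (k + 1)) × (𝔼 m)) (h : k + 1 + m = N' + 1) :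
    wvec p h ⬝ᵥ wvec p h = ‖p.1‖ ^ 2 + ‖p.2‖ ^ 2 := by
  have := sum_repr_sq h (p.1, -p.2)
  rw [norm_neg] at this
  rw [← this]
  simp only [dotProduct, wvec, sq]

/-- **`Xmat 1` is the Householder matrix of `(u, -v)`** (unit `u`, `v`):
`Xmat 1 i j = δᵢⱼ - wᵢ wⱼ = reflMat w i j`. [folklore] -/
theorem Xmat_one_eq_reflMat {p : (𝔼 (k + 1)) × (𝔼 m)} (hu : ‖p.1‖ = 1) (hv : ‖p.2‖ = 1)
    (h : k + 1 + m = N' + 1) : Xmat p h 1 = reflMat (wvec p h) := by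
  ext i j
  have hw2 : wvec p h ⬝ᵥ wvec p h = 2 := by
    rw [wvec_dotProduct_self, hu, hv]; norm_num
  rw [Xmat_apply, XX, LinearMap.comp_apply, Λ_one, SW_eq_sub, map_sub, map_smul,
    Finsupp.sub_apply, Finsupp.smul_apply, (jbasis h).repr_self, smul_eq_mul, reflMat,
    Matrix.sub_apply, Matrix.smul_apply, vecMulVec_apply, hw2, Matrix.one_apply,
    Finsupp.single_apply, smul_eq_mul, div_self two_ne_zero, one_mul]
  have hwj : ⟪p.1, (jbasis h j).1⟫ - ⟪p.2, (jbasis h j).2⟫ = wvec p h j := (wvec_apply p h j).symm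
  rw [hwj, show ((jbasis h).repr (p.1, -p.2)) i = wvec p h i from rfl, mul_comm]
  congr 1
  simp only [eq_comm]

/-- The Householder matrix of a nowhere-zero continuous vector field, as a continuous map into
`NzMat`. [folklore] -/
theorem continuous_reflMat_mk {Y : Type*} [TopologicalSpace Y] {M : ℕ} {f : Y → Fin M → ℝ}
    (hf : Continuous f) (h0 : ∀ y, f y ⬝ᵥ f y ≠ 0) :
    Continuous fun y => (⟨reflMat (f y), by rw [det_reflMat (h0 y)]; norm_num⟩ : NzMat M) :=
  (continuous_reflMat hf h0).subtype_mk _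

/-- **Triviality of the transition on `Sᵏ × Sˡ`.**  For `θ₀ > 0` the map
`(u, v) ↦ Xmat (u, v) θ₀ : Sᵏ × Sˡ → GL_{N'+1}(ℝ)` (`k + 1 + (l + 1) = N' + 1`) is homotopic to
a constant: deform `θ₀` to `1`, where `Xmat 1` is the Householder matrix of `(u, -v)/√2`, a
smooth map `Sᵏ × Sˡ → S^{N'}` from a manifold of dimension `k + l < N'`, which therefore misses a
point and is null-homotopic in the sphere (`exists_sphereMap_near_missing_antipode`).
[folklore] -/
theorem Xmat_homotopic_const {l : ℕ} (h : k + 1 + (l + 1) = N' + 1) {θ₀ : ℝ} (hθ₀ : 0 < θ₀)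
    (hdet : ∀ s : (𝕊 k) × (𝕊 l),
      (Xmat ((s.1 : 𝔼 (k + 1)), (s.2 : 𝔼 (l + 1))) h θ₀).det ≠ 0)
    (hc : Continuous fun s : (𝕊 k) × (𝕊 l) =>
      (⟨Xmat ((s.1 : 𝔼 (k + 1)), (s.2 : 𝔼 (l + 1))) h θ₀, hdet s⟩ : NzMat (N' + 1))) :
    ∃ P₀ : NzMat (N' + 1),
      (⟨_, hc⟩ : C((𝕊 k) × (𝕊 l), NzMat (N' + 1))).Homotopic (ContinuousMap.const _ P₀) := by
  -- the points `(u, v)` as a continuous pair of unit vectors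
  set fp : (𝕊 k) × (𝕊 l) → (𝔼 (k + 1)) × (𝔼 (l + 1)) := fun s => ((s.1 : 𝔼 (k + 1)), (s.2 : 𝔼 (l + 1)))
    with hfp
  have hfpc : Continuous fp :=
    (continuous_subtype_val.comp continuous_fst).prodMk (continuous_subtype_val.comp continuous_snd)
  have hu : ∀ s : (𝕊 k) × (𝕊 l), ‖(fp s).1‖ = 1 := fun s => norm_eq_of_mem_sphere s.1
  have hv : ∀ s : (𝕊 k) × (𝕊 l), ‖(fp s).2‖ = 1 := fun s => norm_eq_of_mem_sphere s.2
  -- ### step 1: deform `θ₀` to `1`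
  have hdet1 : ∀ s : (𝕊 k) × (𝕊 l), (Xmat (fp s) h 1).det ≠ 0 := fun s =>
    det_Xmat_ne_zero (hu s) (hv s) h one_ne_zero
  have hc1 : Continuous fun s : (𝕊 k) × (𝕊 l) => (⟨Xmat (fp s) h 1, hdet1 s⟩ : NzMat (N' + 1)) :=
    (continuous_Xmat h hfpc continuous_const (fun _ => one_ne_zero)).subtype_mk _
  have step1 : (⟨_, hc⟩ : C((𝕊 k) × (𝕊 l), NzMat (N' + 1))).Homotopic ⟨_, hc1⟩ := by
    have hθt : ∀ t : unitInterval, (1 - (t : ℝ)) * θ₀ + (t : ℝ) ≠ 0 := fun t => by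
      have ht0 : 0 ≤ (t : ℝ) := t.2.1
      have ht1 : (t : ℝ) ≤ 1 := t.2.2
      rcases eq_or_lt_of_le ht1 with h1 | h1
      · rw [h1]; norm_num
      · exact (add_pos_of_pos_of_nonneg (mul_pos (by linarith) hθ₀) ht0).ne'
    refine NzMat.homotopic_of_family (fun q => Xmat (fp q.2) h ((1 - (q.1 : ℝ)) * θ₀ + (q.1 : ℝ)))
      ?_ (fun q => det_Xmat_ne_zero (hu q.2) (hv q.2) h (hθt q.1)) _ _ (fun s => by simp [hfp])
      (fun s => by simp [hfp])
    exact continuous_Xmat h (hfpc.comp continuous_snd)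
      (((continuous_const.sub (continuous_subtype_val.comp continuous_fst)).mul
        continuous_const).add (continuous_subtype_val.comp continuous_fst)) fun q => hθt q.1
  -- ### step 2: `Xmat 1 = reflMat w`, `w` the coordinates of `(u, -v)`, `w ⬝ w = 2`
  have hw2 : ∀ s : (𝕊 k) × (𝕊 l), wvec (fp s) h ⬝ᵥ wvec (fp s) h = 2 := fun s => by
    rw [wvec_dotProduct_self, hu, hv]; norm_num
  have hw0 : ∀ s : (𝕊 k) × (𝕊 l), wvec (fp s) h ⬝ᵥ wvec (fp s) h ≠ 0 := fun s => by
    rw [hw2]; exact two_ne_zero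
  have hwc : Continuous fun s : (𝕊 k) × (𝕊 l) => wvec (fp s) h := by
    refine continuous_pi fun i => ?_
    simp only [wvec]
    exact ((jbasis h).coord i).continuous_of_finiteDimensional.comp
      ((continuous_fst.comp hfpc).prodMk (continuous_snd.comp hfpc).neg)
  -- the unit vector `g = w/√2` in `ℝ^{N'+1}`, a continuous map into the sphere `S^{N'}`
  set g : (𝕊 k) × (𝕊 l) → 𝔼 (N' + 1) := fun s =>
    ‖WithLp.toLp 2 (wvec (fp s) h)‖⁻¹ • WithLp.toLp 2 (wvec (fp s) h) with hg
  have hgn0 : ∀ s, WithLp.toLp 2 (wvec (fp s) h) ≠ (0 : 𝔼 (N' + 1)) := fun s h0 => by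
    apply hw0 s
    have : wvec (fp s) h = 0 := by
      have := congrArg WithLp.ofLp h0
      simpa using this
    rw [this, dotProduct_zero]
  have hg1 : ∀ s, ‖g s‖ = 1 := fun s => norm_smul_inv_norm (hgn0 s)
  have hgc : Continuous g := by
    have h1 : Continuous fun s => WithLp.toLp 2 (wvec (fp s) h) := (PiLp.continuous_toLp 2 _).comp hwc
    exact (h1.norm.inv₀ fun s => norm_ne_zero_iff.2 (hgn0 s)).smul h1
  -- ### step 3: `g` misses a point: a nowhere antipodal unit field `b` and a unit `p₀`
  have hd : finrank ℝ ((𝔼 k) × (𝔼 l)) < N' := by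
    rw [Module.finrank_prod, finrank_euclideanSpace_fin, finrank_euclideanSpace_fin]; omega
  obtain ⟨b, p₀, hbc, hb1, hp1, hpb, hbg⟩ :=
    exists_sphereMap_near_missing_antipode ((𝓡 k).prod (𝓡 l)) (S := (𝕊 k) × (𝕊 l)) hd hgc hg1
  -- homotopies in the sphere `S^{N'}`: `g ≃ b ≃ const p₀`
  set gS : C((𝕊 k) × (𝕊 l), Metric.sphere (0 : 𝔼 (N' + 1)) 1) :=
    ⟨fun s => ⟨g s, mem_sphere_zero_iff_norm.2 (hg1 s)⟩, hgc.subtype_mk _⟩ with hgS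
  set bS : C((𝕊 k) × (𝕊 l), Metric.sphere (0 : 𝔼 (N' + 1)) 1) :=
    ⟨fun s => ⟨b s, mem_sphere_zero_iff_norm.2 (hb1 s)⟩, hbc.subtype_mk _⟩ with hbS
  set pS : Metric.sphere (0 : 𝔼 (N' + 1)) 1 := ⟨p₀, mem_sphere_zero_iff_norm.2 hp1⟩ with hpS
  have hgb : gS.Homotopic bS :=
    homotopic_of_forall_add_ne_zero gS bS fun s h0 => hbg s ((add_comm (b s) (g s)).trans h0)
  have hbp : bS.Homotopic (ContinuousMap.const _ pS) :=
    homotopic_of_forall_add_ne_zero bS _ fun s h0 => hpb s ((add_comm p₀ (b s)).trans h0)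
  obtain ⟨G⟩ := hgb.trans hbp
  -- ### step 4: the Householder homotopy `reflMat (G t s)`
  have hG0 : ∀ q : unitInterval × ((𝕊 k) × (𝕊 l)),
      WithLp.ofLp ((G q : Metric.sphere (0 : 𝔼 (N' + 1)) 1) : 𝔼 (N' + 1)) ⬝ᵥ
        WithLp.ofLp ((G q : Metric.sphere (0 : 𝔼 (N' + 1)) 1) : 𝔼 (N' + 1)) ≠ 0 := fun q => by
    rw [dotProduct_self_sphere]; exact one_ne_zero
  refine ⟨⟨reflMat (WithLp.ofLp (p₀ : 𝔼 (N' + 1))), by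
    rw [det_reflMat (by rw [← norm_sq_eq_dotProduct, hp1, one_pow]; exact one_ne_zero)]
    norm_num⟩, step1.trans ?_⟩
  refine NzMat.homotopic_of_family
    (fun q => reflMat (WithLp.ofLp ((G q : Metric.sphere (0 : 𝔼 (N' + 1)) 1) : 𝔼 (N' + 1))))
    ?_ (fun q => by rw [det_reflMat (hG0 q)]; norm_num) _ _ (fun s => ?_) (fun s => ?_)
  · exact continuous_reflMat ((PiLp.continuous_ofLp 2 _).comp
      (continuous_subtype_val.comp G.continuous)) hG0
  · -- `t = 0`: `reflMat (g s) = reflMat w = Xmat 1`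
    have h0 : (G (0, s) : 𝔼 (N' + 1)) = g s := by
      have := G.apply_zero s; rw [this]; rfl
    rw [h0, hg]
    dsimp only
    rw [WithLp.ofLp_smul, WithLp.ofLp_toLp, reflMat_smul (inv_ne_zero (norm_ne_zero_iff.2 (hgn0 s)))]
    exact (Xmat_one_eq_reflMat (hu s) (hv s) h).symm
  · have h1 : (G (1, s) : 𝔼 (N' + 1)) = p₀ := by
      have := G.apply_one s; rw [this]; rfl
    rw [h1]
    rfl

end SurgerySwap

end StableFrames

end Literature.Topology.FourManifolds
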